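import Literature.AlgebraicGeometry.Frobenioids.ArithmeticFrobenioids
import Literature.AlgebraicGeometry.Frobenioids.ArithmeticFrobenioidModel
import Literature.AlgebraicGeometry.Frobenioids.GeometricFrobenioidModel
import Literature.AlgebraicGeometry.Frobenioids.ModelFrobenioidIsFrobenioid
import Literature.AlgebraicGeometry.Frobenioids.ModelFrobenioidStandard
import Literature.AlgebraicGeometry.Frobenioids.PerfFactorial
import Literature.IUT.LogVolume.PrincipalArithmeticDivisors
import HarnessLib

/-!
# Frobenioids I, §6 — SUB-DAG of the printed proofs of Ex. 6.3 «is a Frobenioid», Thm. 6.2 (ii)(iii),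
# Thm. 6.4 (i)–(iv): the intermediate statements (statements-first; cell abc-iut, L1 sub-DAG S3)

Mochizuki, *The geometry of Frobenioids I: the general theory*, Kyushu J. Math. **62** (2008)
293–400, §6, kurims text pp. 109–117 [cite: MochizukiFrdI2008, §6 pp.109-117]. The THEOREMS are typed
in `GeometricFrobenioids.lean` / `ArithmeticFrobenioids.lean` (seat abc-iut-L1-t3: `Thm62ii`, `Thm62iii`,
`Thm62iv`, `Thm64i_frobenioid`, `Thm64i_base`, `Thm64ii`, `Thm64iii`, `Thm64iv`) and several conjuncts are
already PROVED for the CONSTRUCTED models `arithFrobenioid F K`, `geomFrobenioid Γ` (seat abc-iut-L6-t10: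
`Thm64i_base_arith`, `isOfIsotropicType_arith/geom`, `not_isOfGroupLikeType_arith/geom`, `Thm62ii_holds`,
`Thm62iv_holds`, `Ex63_primes_holds`, `Lemma65ii_holds`, …). THIS FILE cuts the PRINTED PROOFS (p. 111
l. 17 – p. 112 l. 26; p. 115 l. 14 – p. 116 l. 35) into NAMED INTERMEDIATE STATEMENTS — each a
`def … : Prop` (a named fact to be discharged by a `theorem …_holds`, never asserted here) — following
the lemma list `HOME/staging/L1/L1-t1/gen2/S3-LEMMA-LIST.md` (node ids `E63/Lnn`, `T62ii/Lnn`, `T62iii/Lnn`,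
`T64i/Lnn` … `T64iv/Lnn` in the docstrings). Three kinds of rows:
* DATA-LEVEL rows: closed statements over Mathlib number fields / the constructed models — dischargeable now;
* CLASSICAL inputs named by the printed proof («well-known Dirichlet unit theorem», «Tchebotarev's density
  theorem», [NSW] Thm. 12.2.5, order-preserving additive automorphisms of `ℝ`) — closed Mathlib-level facts;
* INTERFACE-LEVEL rows (transport along THE equivalences via Cor. 4.10/4.11 (iii), Thm. 3.4, Cor. 5.4, Prop. 5.5
  (iii); «model / birationally Frobenius-normalized type») are NOT re-typed (parameters of abc-iut-L1-t3's schemas;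
  lemma list rows «input-gated»); only their data-level cores appear below. Nothing here asserts anything about abc.
-/

noncomputable section

namespace Literature.AlgebraicGeometry.Frobenioids

open CategoryTheory NumberField IsDedekindDomain

universe u v

/-! ### Mathlib-level vocabulary used by several rows -/

/-- The rational prime below a finite place `w` of a number field (the residue characteristic of `v`;
as in abc-iut-L1-t3's `Thm64iii`: the least prime factor of `N(𝔭_w)`). [cite: MochizukiFrdI2008, Thm. 6.4 (iii) p.115] -/
def residueChar {L : Type} [Field L] [NumberField L] (w : FinitePlace L) : ℕ :=
  (Ideal.absNorm w.maximalIdeal.asIdeal).minFac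

/-- `log N(w) = log #(O_L/𝔭_w)` — the value of `deg^arith_L` on the generator of `ord(O_w^▷) ≅ ℤ_{≥0}`
(Ex. 6.3 p. 114 l. 1). [cite: MochizukiFrdI2008, Ex. 6.3 p.114] -/
def logNorm {L : Type} [Field L] [NumberField L] (w : FinitePlace L) : ℝ :=
  Real.log (Ideal.absNorm w.maximalIdeal.asIdeal : ℝ)

/-- The finite places of `L` over the rational prime `p` ("valuations `∈ 𝕍(L_i)` … that lie over the same
valuation of `ℚ`", p. 116 l. 19). [cite: MochizukiFrdI2008, Thm. 6.4 (iv) p.116] -/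
def placesOver (L : Type) [Field L] [NumberField L] (p : ℕ) : Set (FinitePlace L) :=
  {w | residueChar w = p}

/-- "`p` splits completely in `L`": `p` is prime and the number of places of `L` over `p` is `[L : ℚ]`
(p. 116 l. 21–23: "`p_i` splits completely in `L_i` if and only if `deg(L_i, v_i) = [L_i : ℚ]`", taken
here as the DEFINITION; the equivalence with `e = f = 1` at all `w ∣ p` is row T64iv/L02).
[cite: MochizukiFrdI2008, Thm. 6.4 (iv) p.116] -/
def SplitsCompletely (L : Type) [Field L] [NumberField L] (p : ℕ) : Prop :=
  p.Prime ∧ (placesOver L p).ncard = Module.finrank ℚ L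

/-! ### A. Example 6.3: "by Theorem 5.2, (ii), this data determines a [model] Frobenioid" (p. 113 l. 20–22) -/

section Ex63

variable (F : Type) [Field F] [NumberField F] (K : Type) [Field K] [Algebra F K]

/-- **E63/L06** — "Thus, by Theorem 5.2, (ii), this data determines a [model] Frobenioid `C_{F̃/F}`"
(p. 113 l. 20–21): the functor `C_{K/F} → F_Φ` of the CONSTRUCTED arithmetic model (`arithFrobenioid F K`,
abc-iut-L6-t10) IS a Frobenioid (Def. 1.3). Discharge = abc-iut-found's PROVED Thm. 5.2 (ii)
`ModelFrobenioid.isFrobenioid` applied to the standing hypotheses E63/L01–L05 (abc-iut-L6-t10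
`arith_hypotheses`). [cite: MochizukiFrdI2008, Ex. 6.3 p.113] -/
def Ex63_isFrobenioid : Prop :=
  PreFrobenioid.IsFrobenioid
    (ModelFrobenioid.toElem (arithDivisorFunctor F K) (unitsFunctor F K) (divNatTrans F K))

/-- **E63/L05** (the standing hypotheses of Thm. 5.2 for the data `(D, Φ, B, B → Φ^gp)` of Ex. 6.3: `Φ` a
divisorial monoid on `D`, `B` a group-like monoid on `D`, `D = B(G)⁰` connected and totally epimorphic;
p. 113 l. 11–13 "`Φ`, `B` determine monoids on `D`") — as one named statement (abc-iut-L6-t10's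
`arith_hypotheses` discharges it). [cite: MochizukiFrdI2008, Ex. 6.3 p.113] -/
def Ex63_hypotheses : Prop :=
  ModelFrobenioid.Hypotheses (arithDivisorFunctor F K) (unitsFunctor F K)

/-- **E63/L06, composition** (statement): E63/L05 ⟹ E63/L06 — literally abc-iut-found's
`ModelFrobenioid.isFrobenioid` (p409456). [cite: MochizukiFrdI2008, Ex. 6.3 p.113] -/
theorem Ex63_isFrobenioid_of_hypotheses (h : Ex63_hypotheses F K) : Ex63_isFrobenioid F K :=
  ModelFrobenioid.isFrobenioid h.isMonoidOn h.isDivisorial h.isMonoidOn_rat h.isGroupLike_rat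
    h.isGraphConnected h.isTotallyEpimorphic

end Ex63

/-! ### B. Theorem 6.2 (ii) (p. 111 l. 17–29) -/

section Thm62

variable {K : Type} [Field K] {Kt : Type} [Field Kt] [Algebra K Kt] (Γ : GeometricDivisorData K Kt)

/-- **T62ii/L03** — the standing hypotheses of Thm. 5.2 for the data of Ex. 6.1 (p. 109 l. 30–34: "`Φ` … a
perf-factorial divisorial monoid on `D`", "`B` … a group-like monoid on `D`", `D = B(G)⁰` connected and
totally epimorphic) for the CONSTRUCTED `geomDivisorFunctor Γ`, `geomUnitsFunctor Γ` (abc-iut-L6-t10): the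
premise behind the hypothesis `hF` of `Thm62ii`. **S3-F1 (abc-iut-L6-t10): FALSE AS TYPED for
NON-saturated v3 instances `Γ` (`Φ(L) = ⟨2P, 3P⟩` is not divisorial); intended reading: `Γ` saturated (p. 109,
"`Φ(L)^gp` = Cartier divisors"); guarded discharge `MotivatingExamplesSubHolds.…_of_sub_mem (hsub)`.** [cite: MochizukiFrdI2008, Ex. 6.1 p.109] -/
def Thm62_geomHypotheses : Prop :=
  ModelFrobenioid.Hypotheses (geomDivisorFunctor Γ) (geomUnitsFunctor Γ)

/-- **T62ii/L04** — "`C_i` the associated model Frobenioid of Theorem 5.2, (ii)" (p. 110 l. 30): the functor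
`C_{K̃/K} → F_Φ` of the constructed geometric model IS a Frobenioid (the hypothesis `hF` of `Thm62ii`). **S3-F1 (abc-iut-L6-t10): FALSE AS TYPED for
NON-saturated v3 instances `Γ` (`Φ(L) = ⟨2P, 3P⟩` is not divisorial); intended reading: `Γ` saturated (p. 109,
"`Φ(L)^gp` = Cartier divisors"); guarded discharge `MotivatingExamplesSubHolds.…_of_sub_mem (hsub)`.**
[cite: MochizukiFrdI2008, Thm. 6.2 p.110] -/
def Thm62_geomIsFrobenioid : Prop :=
  PreFrobenioid.IsFrobenioid
    (ModelFrobenioid.toElem (geomDivisorFunctor Γ) (geomUnitsFunctor Γ) (geomDivNatTrans Γ))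

/-- T62ii/L04 ⇐ T62ii/L03, composition (abc-iut-found's Thm. 5.2 (ii)). [cite: MochizukiFrdI2008, Thm. 6.2 p.110] -/
theorem Thm62_geomIsFrobenioid_of_hypotheses (h : Thm62_geomHypotheses Γ) : Thm62_geomIsFrobenioid Γ :=
  ModelFrobenioid.isFrobenioid h.isMonoidOn h.isDivisorial h.isMonoidOn_rat h.isGroupLike_rat
    h.isGraphConnected h.isTotallyEpimorphic

/-- **T62ii/L06** — Thm. 6.2 (ii) UNCONDITIONALLY for the constructed model: `C` is a Frobenioid AND the
Frobenius functor `Ψ` is isomorphic to the naive Frobenius functor of degree `p` (abc-iut-L1-t3's `Thm62ii Γ p`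
quantifies over the hypothesis `hF`; abc-iut-L6-t10's `Thm62ii_holds` proves it; with T62ii/L04 the
hypothesis is met). **S3-F1 (abc-iut-L6-t10): FALSE AS TYPED for
NON-saturated v3 instances `Γ` (`Φ(L) = ⟨2P, 3P⟩` is not divisorial); intended reading: `Γ` saturated (p. 109,
"`Φ(L)^gp` = Cartier divisors"); guarded discharge `MotivatingExamplesSubHolds.…_of_sub_mem (hsub)`.** [cite: MochizukiFrdI2008, Thm. 6.2 (ii) p.111] -/
def Thm62ii_unconditional (p : ℕ) [Fact p.Prime] [CharP K p] : Prop :=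
  ∃ hF : PreFrobenioid.IsFrobenioid
      (ModelFrobenioid.toElem (geomDivisorFunctor Γ) (geomUnitsFunctor Γ) (geomDivNatTrans Γ)),
    Nonempty (frobeniusPullbackFunctor Γ ⟨p, (Fact.out : p.Prime).pos⟩ ≅
      PreFrobenioid.naiveFrobeniusOf hF ⟨p, (Fact.out : p.Prime).pos⟩)

/-- T62ii/L06 ⇐ T62ii/L04 + `Thm62ii` (composition). [cite: MochizukiFrdI2008, Thm. 6.2 (ii) p.111] -/
theorem Thm62ii_unconditional_of (p : ℕ) [Fact p.Prime] [CharP K p] (hF : Thm62_geomIsFrobenioid Γ)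
    (h : Thm62ii Γ p) : Thm62ii_unconditional Γ p :=
  ⟨hF, h hF⟩

/-! ### C. Theorem 6.2 (iii) (p. 111 l. 30 – p. 112 l. 16) -/

/-- **T62iii/L05a = T64i/L09 core — the generic "permutation–scaling" lemma used three times in §6**
(p. 112 l. 1–3: "`α` maps every prime divisor `D` to `D` [i.e., not to some `n · D`, where `n ≥ 2`]";
p. 112 l. 12–15 and p. 115 l. 22–23: "`α` … acts by multiplication by `λ ∈ ℚ_{>0}` on `Φ^birat(L)^pf` …
the order … of the zero [or pole] of highest order … is preserved by `α`, hence `λ = 1`"): an endomorphism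
of a free commutative monoid/`ℚ`-module induced by a PERMUTATION of the basis cannot scale a nonzero
vector by `λ ≠ 1`. [cite: MochizukiFrdI2008, Thm. 6.2 (iii) p.112] -/
def PermScalingTrivial : Prop :=
  ∀ {X : Type} (e : X ≃ X) (D : X →₀ ℚ) (c : ℚ), D ≠ 0 → 0 < c → Finsupp.mapDomain e D = c • D → c = 1

/-- **T62iii/L05** — "thus, we conclude that `Φ` is non-dilating" (p. 112 l. 3), for the constructed
`geomDivisorFunctor Γ` (Def. 1.1 (i) `IsNonDilatingOn`; abc-iut-L6-t10's plan: ℚ-Cartier multiples +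
finite-order automorphisms + T62iii/L05a). [cite: MochizukiFrdI2008, Thm. 6.2 (iii) p.112] -/
def Thm62iii_L05_nonDilating : Prop := IsNonDilatingOn (geomDivisorFunctor Γ)

/-- **T62iii/L06** — "hence that `C` is of standard type" (p. 112 l. 3–4): for the constructed model;
composition of Thm. 5.2 (iii) (abc-iut-L1-t2's `StandardTypeIff`, PROVED `standardTypeIff_holds`) with
T62iii/L04 (`FinSubextCat.isOfFSMFFType`) and T62iii/L05 (clause (a) is vacuous: `Φ ≠ 0`,
`GeometricDivisorData.exists_phi_ne_zero`). **S3-F1 (abc-iut-L6-t10): FALSE AS TYPED for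
NON-saturated v3 instances `Γ` (`Φ(L) = ⟨2P, 3P⟩` is not divisorial); intended reading: `Γ` saturated (p. 109,
"`Φ(L)^gp` = Cartier divisors"); guarded discharge `MotivatingExamplesSubHolds.…_of_sub_mem (hsub)`.** [cite: MochizukiFrdI2008, Thm. 6.2 (iii) p.112] -/
def Thm62iii_L06_standard : Prop := (geomFrobenioidOps Γ).IsOfStandardType

/-- **T62iii/L07** — the DATA-LEVEL content of "it follows formally [cf. Definition 4.5, (ii)] that `C` is of
[strictly] rational type" under the support hypothesis of Thm. 6.2 (iii) (p. 112 l. 4–8): every prime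
divisor `P ∈ D_L` lies in the support of a Cartier effective `D` but not of a Cartier effective `E` with
`D − E = div(f)`, `f ∈ B(L)` (zero and pole parts of a suitable power `f^{±n}`, `D_K` being `K̃`-`ℚ`-Cartier;
Def. 4.5 (ii) with `Φ^birat(L) = div(B(L))`, Thm. 5.2 (ii)). [cite: MochizukiFrdI2008, Thm. 6.2 (iii) p.112] -/
def Thm62iii_L07_strictlyRational_data : Prop :=
  (∀ (X : FinSubextCat K Kt) (P : Γ.primeDiv X), ∃ f : Γ.B X, (Multiplicative.toAdd (Γ.div X f)) P ≠ 0) →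
    ∀ (X : FinSubextCat K Kt) (P : Γ.primeDiv X), ∃ (f : Γ.B X) (D E : Γ.primeDiv X →₀ ℕ),
      D ∈ Γ.Phi X ∧ E ∈ Γ.Phi X ∧
        Multiplicative.toAdd (Γ.div X f) = DivisorCoeff.toInt D - DivisorCoeff.toInt E ∧
          P ∈ D.support ∧ P ∉ E.support

/-- **T62iii/L09** — the DATA-LEVEL core of "every object of `(C^un-tr)^birat` is Frobenius-compact"
(p. 112 l. 8–15): an automorphism `σ : Spec L ⥲ Spec L` of `D` pulls divisors back by a PERMUTATION of
`D_L` with ramification `1` (functoriality of `ram`), so if `σ^*` acts on `Φ^birat(L)^pf ⊆ ℚ[D_L]` by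
`λ ∈ ℚ_{>0}` on a nonzero element then `λ = 1` (T62iii/L05a). [cite: MochizukiFrdI2008, Thm. 6.2 (iii) p.112] -/
def Thm62iii_L09_frobCompact_data : Prop :=
  ∀ (X : FinSubextCat K Kt) (σ : X ≅ X) (d : Γ.primeDiv X →₀ ℚ) (c : ℚ), d ≠ 0 → 0 < c →
    DivisorCoeff.pull (Γ.over σ.hom) (Γ.ram σ.hom) (Γ.over_finite σ.hom) d = c • d → c = 1

end Thm62

/-! ### D. Theorem 6.4 (i) (p. 114; proof p. 115 l. 14–33) -/

section Thm64i

variable (F : Type) [Field F] [NumberField F] (K : Type) [Field K] [Algebra F K]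

/-- **T64i/L02** — "`Φ` is … perf-factorial" (p. 115 l. 15–16; Ex. 6.3 p. 113 l. 13 "one verifies
immediately that `Φ(L) ≠ 0` is perf-factorial"): every `Φ(L) = ⊕_{fin} ℤ_{≥0} ⊕ ⊕_{inf} ℝ_{≥0}` is a
perf-factorial monoid (Def. 2.4 (i), abc-iut-L1-t14's `IsPerfFactorial`). [cite: MochizukiFrdI2008, Thm. 6.4 (i) p.115] -/
def Thm64i_L02_perfFactorial : Prop :=
  ∀ (L : Type) [Field L] [NumberField L], IsPerfFactorial (Multiplicative (EffArithDivisor L))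

/-- **T64i/L05** (clean form) — "any automorphism of a number field that fixes all of the valuations of the
number field is clearly equal to the identity automorphism" (p. 115 l. 18–19). (The finite-place form
`NumberFields.exists_map_heightOneSpectrum_ne` is PROVED in the tree and used by abc-iut-L6-t10's
`movesSomeGalois_arith`.) [cite: MochizukiFrdI2008, Thm. 6.4 (i) p.115] -/
def Thm64i_L05_autFixingPlaces : Prop :=
  ∀ (L : Type) [Field L] [NumberField L] (σ : L ≃+* L),
    (∀ w : IsDedekindDomain.HeightOneSpectrum (𝓞 L),
        Ideal.map (RingOfIntegers.mapRingEquiv σ) w.asIdeal = w.asIdeal) → σ = RingEquiv.refl L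

/-- **T64i/L06** — "it follows immediately that `Φ` is non-dilating" (p. 115 l. 19–20), for the constructed
`arithDivisorFunctor F K` (abc-iut-L6-t10 STAGED `arithDivisorFunctor_isNonDilatingOn`: T64i/L05 +
T62iii/L05a with finite-order `σ`). [cite: MochizukiFrdI2008, Thm. 6.4 (i) p.115] -/
def Thm64i_L06_nonDilating : Prop := IsNonDilatingOn (arithDivisorFunctor F K)

/-- **T64i/L08** — the DATA-LEVEL content of "it is immediate from the definition of `B` that `C` is of
[strictly] rational type" (p. 115 l. 21–22): every place lies in the support of the zero divisor, and outside
the support of the pole divisor, of some `f ∈ B(L) = L^×` — at a finite place an element of positive order,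
at an archimedean place an element of absolute value `≠ 1`. [cite: MochizukiFrdI2008, Thm. 6.4 (i) p.115] -/
def Thm64i_L08_strictlyRational_data : Prop :=
  ∀ (L : Type) [Field L] [NumberField L],
    (∀ w : FinitePlace L, ∃ f : Lˣ, 0 < ordFin L w f ∧ ∀ w' : FinitePlace L, w' ≠ w → 0 ≤ ordFin L w' f) ∧
      ∀ v : InfinitePlace L, ∃ f : Lˣ, Real.log (v (f : L)) ≠ 0

/-- **T64i/L09** — the DATA-LEVEL core of "every object of `(C^un-tr)^birat` is Frobenius-compact"
(p. 115 l. 22–23): an automorphism `σ` of `L` pulls arithmetic divisors back by a permutation of the places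
(`w ↦ w ∘ σ`, ramification `1`); if `σ^* d = λ · d` for a nonzero `d ∈ Φ^birat(L) ⊗ ℚ` and `λ ∈ ℚ_{>0}`,
then `λ = 1` (T62iii/L05a at the finite and at the infinite places). [cite: MochizukiFrdI2008, Thm. 6.4 (i) p.115] -/
def Thm64i_L09_frobCompact_data : Prop :=
  ∀ (L : Type) [Field L] [NumberField L] (σ : L ≃+* L) (d : (FinitePlace L →₀ ℚ) × (InfinitePlace L → ℚ))
    (c : ℚ), d ≠ 0 → 0 < c →
      (Finsupp.mapDomain (fun w : FinitePlace L => ArithPullback.underPlace (σ : L →+* L) w) d.1,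
        fun v : InfinitePlace L => d.2 (v.comap (σ : L →+* L))) = c • d → c = 1

/-- **T64i/L13** — `δ_A : Pic_Φ(A) → ℝ` is SURJECTIVE "formally" (p. 115 l. 27–28): `deg_L` attains every
real value. Stated VERBATIM in the form asked by the discharger abc-iut-L1-t3 (gen 3), over the tree's real
arithmetic divisors `ADiv_ℝ(L) = 𝕍(L) →₀ ℝ` and `deg_L` of `Literature.IUT.LogVolume` (bridged to Ex. 6.3's
`Φ(L)^gp` by `ArithmeticDivisorsFrdBridge`). [cite: MochizukiFrdI2008, Thm. 6.4 (i) p.115] -/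
def Thm64i_L13_degSurjective (L : Type) [Field L] [NumberField L] : Prop :=
  Function.Surjective (Literature.IUT.LogVolume.degF L)

/-- **T64i/L14 — "an immediate consequence of the well-known Dirichlet unit theorem"** (p. 115 l. 28–32):
"the image of `Φ^birat(L) ⊗_ℤ ℝ = (L^×) ⊗_ℤ ℝ` in `(Φ^rlf_factor)^gp(L)` is equal to the set of elements of
`(Φ^rlf_factor)^gp(L)` with finite support whose image under `deg^arith_L` is `0`" — DATA form, VERBATIM as
asked by the discharger abc-iut-L1-t3 (gen 3): every real arithmetic divisor of degree `0` is an `ℝ`-linear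
combination of principal divisors `ADiv(f)`, `f ∈ L^×` (class-group finiteness for the finite part,
Dirichlet's unit theorem — Mathlib `NumberField.Units.unitLattice_span_eq_top` — for the archimedean
part). The converse inclusion is the product formula (`APrc_le_ker_degF`, PROVED). [cite: MochizukiFrdI2008, Thm. 6.4 (i) p.115] -/
def Thm64i_L14_DirichletSpan (L : Type) [Field L] [NumberField L] : Prop :=
  LinearMap.ker (Literature.IUT.LogVolume.degF L) ≤
    Submodule.span ℝ ((Literature.IUT.LogVolume.APrc L : AddSubgroup (Literature.IUT.LogVolume.ADivisor L)) :
      Set (Literature.IUT.LogVolume.ADivisor L))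

/-- **T64i/L15, data-level composition** — "`deg^arith_L` determines an isomorphism of groups
`δ_A : Pic_Φ(A) ⥲ ℝ`" (p. 114, (i) last sentence; Thm. 5.1 (i): for a Frobenius-trivial `A ∈ Ob(C^rlf)`
over `Spec L`, `Pic_Φ(A) = (Φ^rlf)^gp(L)` modulo the `ℝ`-span of the principal divisors): the `ℝ`-span of
`APrc(L)` IS the kernel of `deg_L`, and `deg_L` is onto — so the degree induces `ADiv_ℝ(L)/⟨APrc(L)⟩_ℝ ⥲ ℝ`
⇐ T64i/L13 + T64i/L14 + product formula. The identification of THE `Pic_Φ(A)` (abc-iut-L1-t3's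
`ArithRealification.Pic/δ`, Thm. 5.1 constructions) with this quotient is the input-gated interface row.
[cite: MochizukiFrdI2008, Thm. 6.4 (i) p.114] -/
def Thm64i_L15_deltaIso_data (L : Type) [Field L] [NumberField L] : Prop :=
  Submodule.span ℝ ((Literature.IUT.LogVolume.APrc L : AddSubgroup (Literature.IUT.LogVolume.ADivisor L)) :
        Set (Literature.IUT.LogVolume.ADivisor L)) =
      LinearMap.ker (Literature.IUT.LogVolume.degF L) ∧
    Function.Surjective (Literature.IUT.LogVolume.degF L)

end Thm64i

/-! ### E. Theorem 6.4 (ii) (p. 114; proof p. 115 l. 34 – p. 116 l. 3) -/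

/-- **T64ii/L03 — the classical step behind "compatible with the 'order structure' of `ℝ`"** (p. 115
l. 36 – p. 116 l. 1): an order-preserving additive bijection `ℝ → ℝ` is multiplication by a positive real
number — whence THE degree `deg(Ψ^rlf) ∈ ℝ_{>0}`. [cite: MochizukiFrdI2008, Thm. 6.4 (ii) p.115] -/
def Thm64ii_L03_monotoneAddAut : Prop :=
  ∀ φ : ℝ ≃+ ℝ, Monotone φ → ∃ c : ℝ, 0 < c ∧ ∀ x : ℝ, φ x = c * x

section Thm64ii

variable {F₁ : Type} [Field F₁] [NumberField F₁] {K₁ : Type} [Field K₁] [Algebra F₁ K₁] [IsGalois F₁ K₁]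
variable {F₂ : Type} [Field F₂] [NumberField F₂] {K₂ : Type} [Field K₂] [Algebra F₂ K₂] [IsGalois F₂ K₂]
variable {Rlf₁ : Type u} [Category.{v} Rlf₁] {Rlf₂ : Type u} [Category.{v} Rlf₂]
variable (R₁ : ArithRealification (F := F₁) (K := K₁) Rlf₁) (R₂ : ArithRealification (F := F₂) (K := K₂) Rlf₂)

/-- **T64ii/L02** — "the isomorphism of groups `Pic_Φ(A₁) ⥲ Pic_Φ(A₂)` determined by `Ψ^rlf` … is compatible
with the 'order structure' induced on both sides [via `δ_{A₁}`, `δ_{A₂}`] by the 'order structure' of `ℝ`.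
[Indeed, this compatibility follows from the fact that the isomorphism in question arises from an isomorphism of
monoids `Φ₁^rlf(A₁) ⥲ Φ₂^rlf(A₂)`.]" (p. 115 l. 35 – p. 116 l. 2; T64ii/L01 = Cor. 4.10 / 4.11 (iii), the
input-gated origin of `picMap`). Over abc-iut-L1-t3's data `R₁`, `R₂`, `Ψ`, `picMap` (SCHEMA at junk
parameters, faithful at THE constructions — same status as `Thm64ii`). [cite: MochizukiFrdI2008, Thm. 6.4 (ii) p.115] -/
def Thm64ii_L02_orderCompat (Ψ : Rlf₁ ≌ Rlf₂)
    (picMap : ∀ A : Rlf₁, R₁.Pic A ≃+ R₂.Pic (Ψ.functor.obj A)) : Prop :=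
  ∀ (A : Rlf₁) (hA : R₁.ops.IsFrobeniusTrivial A) (hA' : R₂.ops.IsFrobeniusTrivial (Ψ.functor.obj A)),
    Monotone fun t : ℝ => R₂.δ _ hA' (picMap A ((R₁.δ A hA).symm t))

/-- **T64ii/L04 + L05, composition** (statement): order-compatibility (T64ii/L02) with ONE comparison constant
for all Frobenius-trivial `A₁` (T64ii/L04: naturality of `δ`, `picMap` along the connected base) gives
`Thm64ii` via T64ii/L03. Stated as the implication to be discharged. [cite: MochizukiFrdI2008, Thm. 6.4 (ii) p.114] -/
def Thm64ii_of_orderCompat (Ψ : Rlf₁ ≌ Rlf₂)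
    (picMap : ∀ A : Rlf₁, R₁.Pic A ≃+ R₂.Pic (Ψ.functor.obj A)) : Prop :=
  Thm64ii_L02_orderCompat R₁ R₂ Ψ picMap →
    (∀ (A B : Rlf₁) (hA : R₁.ops.IsFrobeniusTrivial A) (hA' : R₂.ops.IsFrobeniusTrivial (Ψ.functor.obj A))
        (hB : R₁.ops.IsFrobeniusTrivial B) (hB' : R₂.ops.IsFrobeniusTrivial (Ψ.functor.obj B)) (t : ℝ),
        R₂.δ _ hA' (picMap A ((R₁.δ A hA).symm t)) = R₂.δ _ hB' (picMap B ((R₁.δ B hB).symm t))) →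
      Thm64ii R₁ R₂ Ψ picMap

end Thm64ii

/-! ### F. Theorem 6.4 (iii) (pp. 114–115; proof p. 116 l. 4–16) — the numeric core is concrete -/

/-- **T64iii/L02, data-level core** — archimedean places correspond to archimedean places (p. 115 l. 6–8,
"`v₀` of `ℚ`" including `∞`): the `𝔭`-component of `Φ(L)^pf` is `ℚ_{≥0}` at a finite and `ℝ_{≥0}` at an
infinite place, and these monoids are distinguished by COMMENSURABILITY of nonzero elements — so a monoid
isomorphism `Φ₁^pf(L₁) ⥲ Φ₂^pf(L₂)` (Cor. 4.11 (iii)) cannot match them. [cite: MochizukiFrdI2008, Thm. 6.4 (iii) p.115] -/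
def Thm64iii_L02_commensurability : Prop :=
  (∀ x y : ℚ, 0 < x → 0 < y → ∃ m n : ℕ, 0 < m ∧ 0 < n ∧ (m : ℚ) * x = n * y) ∧
    ¬ ∀ x y : ℝ, 0 < x → 0 < y → ∃ m n : ℕ, 0 < m ∧ 0 < n ∧ (m : ℝ) * x = n * y

/-- **T64iii/L04 — "one verifies immediately that there exist three nonarchimedean valuations `w₁, w₃, w₅ ∈ 𝕍(L₁)`
… such that `p₁, …, p₆` are distinct"** (p. 116 l. 5–9): pure combinatorics of a bijection of finite places
that changes every residue characteristic (finite fibres, infinitely many rational primes below).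
[cite: MochizukiFrdI2008, Thm. 6.4 (iii) p.116] -/
def Thm64iii_L04_threePairs : Prop :=
  ∀ (L₁ : Type) [Field L₁] [NumberField L₁] (L₂ : Type) [Field L₂] [NumberField L₂]
    (π : FinitePlace L₁ ≃ FinitePlace L₂), (∀ w, residueChar (π w) ≠ residueChar w) →
      ∃ w₁ w₃ w₅ : FinitePlace L₁,
        [residueChar w₁, residueChar (π w₁), residueChar w₃, residueChar (π w₃), residueChar w₅,
          residueChar (π w₅)].Nodup

/-- **T64iii/L03 + L06 — the NUMERIC CORE of Thm. 6.4 (iii)** (p. 116 l. 4–15): if `deg > 0` and a bijection `π`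
of finite places satisfies, for every `w₁ ↦ w₂`, `deg · log N(w₁) = q · log N(w₂)` with `q ∈ ℚ_{>0}` (T64iii/L03:
the `δ`-relation of (ii) on the generator class at `w₁`, which `(Ψ^pf)^un-tr` carries to a positive RATIONAL
multiple of the generator class at `w₂`), then `deg ∈ ℚ_{>0}` (else T64iii/L04 + Lem. 6.5 (ii) give a
contradiction) and every `w₁ ↦ w₂` lies over the same rational prime (Lem. 6.5 (i)).
[cite: MochizukiFrdI2008, Thm. 6.4 (iii) p.116] -/
def Thm64iii_L06_degRational : Prop :=
  ∀ (L₁ : Type) [Field L₁] [NumberField L₁] (L₂ : Type) [Field L₂] [NumberField L₂]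
    (deg : ℝ) (π : FinitePlace L₁ ≃ FinitePlace L₂), 0 < deg →
      (∀ w, ∃ q : ℚ, 0 < q ∧ deg * logNorm w = q * logNorm (π w)) →
        (∃ q : ℚ, 0 < q ∧ deg = q) ∧ ∀ w, residueChar (π w) = residueChar w

/-! ### G. Theorem 6.4 (iv) (p. 115; proof p. 116 l. 17–35) -/

/-- **T64iv/L02** — "`p_i` splits completely in `L_i` if and only if `deg(L_i, v_i) = [L_i : ℚ]`" (p. 116
l. 21–23), elementary part: the number of places over `p` is at most `[L : ℚ]` (`Σ_{w ∣ p} e_w f_w = [L : ℚ]`),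
with equality iff all `e_w = f_w = 1`. [cite: MochizukiFrdI2008, Thm. 6.4 (iv) p.116] -/
def Thm64iv_L02_placesOver_le : Prop :=
  ∀ (L : Type) [Field L] [NumberField L] (p : ℕ), p.Prime →
    (placesOver L p).Finite ∧ (placesOver L p).ncard ≤ Module.finrank ℚ L ∧
      ((placesOver L p).ncard = Module.finrank ℚ L ↔
        ∀ w ∈ placesOver L p,
          w.maximalIdeal.asIdeal.ramificationIdx ℤ = 1 ∧ w.maximalIdeal.asIdeal.inertiaDeg ℤ = 1)

/-- **T64iv/L03 — "by Tchebotarev's density theorem [cf., e.g., [Lang2], Chapter VIII, §4, Theorem 10], it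
follows that `[L_i : ℚ]` is equal to the maximum of the `deg(L_i, v_i)`"** (p. 116 l. 19–21): SOME rational
prime splits completely in `L` (classical; Chebotarev in print — an elementary route exists via prime
divisors of the values of a minimal polynomial in the Galois closure). [cite: MochizukiFrdI2008, Thm. 6.4 (iv) p.116] -/
def Thm64iv_L03_existsSplitPrime : Prop :=
  ∀ (L : Type) [Field L] [NumberField L], ∃ p : ℕ, SplitsCompletely L p

/-- **T64iv/L04** — a bijection of finite places preserving the rational prime below (Thm. 6.4 (iii)) preserves
the split degrees `deg(L_i, v_i)`, hence (T64iv/L03) `[L₁ : ℚ] = [L₂ : ℚ]` and "`p` splits completely in `L₁`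
if and only if `p` splits completely in `L₂`" (p. 116 l. 23–25). [cite: MochizukiFrdI2008, Thm. 6.4 (iv) p.116] -/
def Thm64iv_L04_degreeEq : Prop :=
  ∀ (L₁ : Type) [Field L₁] [NumberField L₁] (L₂ : Type) [Field L₂] [NumberField L₂]
    (π : FinitePlace L₁ ≃ FinitePlace L₂), (∀ w, residueChar (π w) = residueChar w) →
      (∀ p, (placesOver L₁ p).ncard = (placesOver L₂ p).ncard) ∧
        Module.finrank ℚ L₁ = Module.finrank ℚ L₂ ∧ ∀ p, SplitsCompletely L₁ p ↔ SplitsCompletely L₂ p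

/-- **T64iv/L05 — the numeric core "`deg(Ψ^rlf) = 1`"** (p. 116 l. 25–27): at a completely split `p`,
`deg^arith_{L_i}` maps the generator of `Φ_i(L_i)_{v_i} ≅ ℤ_{≥0}` to `log p`; THE equivalence `Ψ` carries
generator to generator (T64iv/L01: `Ψ` induces monoid isomorphisms `Φ₁(L₁) ⥲ Φ₂(L₂)`, Cor. 4.11 (iii)), so
the `δ`-relation of (ii) reads `deg · log N(v₁) = log N(v₂)` with `N(v₁) = N(v₂) = p`, whence `deg = 1`.
[cite: MochizukiFrdI2008, Thm. 6.4 (iv) p.116] -/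
def Thm64iv_L05_degOne : Prop :=
  ∀ (L₁ : Type) [Field L₁] [NumberField L₁] (L₂ : Type) [Field L₂] [NumberField L₂]
    (deg : ℝ) (v₁ : FinitePlace L₁) (v₂ : FinitePlace L₂),
      (Ideal.absNorm v₁.maximalIdeal.asIdeal).Prime →
        Ideal.absNorm v₁.maximalIdeal.asIdeal = Ideal.absNorm v₂.maximalIdeal.asIdeal →
          deg * logNorm v₁ = logNorm v₂ → deg = 1

/-- **T64iv/L06 — "[again by Tchebotarev's density theorem — cf., e.g., [NSW], Theorem 12.2.5] that
`L₁ ⊆ L₂`"** (p. 116 l. 29–33; Bauer's theorem): if `L₁` is Galois over `ℚ` and every rational prime that has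
a place of residue degree one in `L₂`, outside a finite set, splits completely in `L₁`, then `L₁` embeds into
`L₂`. Classical NAMED FACT (Chebotarev). [cite: MochizukiFrdI2008, Thm. 6.4 (iv) p.116] -/
def Thm64iv_L06_Bauer : Prop :=
  ∀ (L₁ : Type) [Field L₁] [NumberField L₁] (L₂ : Type) [Field L₂] [NumberField L₂], IsGalois ℚ L₁ →
    ∀ S : Finset ℕ,
      (∀ p : ℕ, p.Prime → p ∉ S →
          (∃ w : FinitePlace L₂, Ideal.absNorm w.maximalIdeal.asIdeal = p) → SplitsCompletely L₁ p) →
        Nonempty (L₁ →+* L₂)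

/-- **T64iv/L07** — "hence that `L₁ = L₂` [since we have already seen that `[L₁ : ℚ] = [L₂ : ℚ]`]" (p. 116
l. 33–34): an embedding of number fields of equal degree is an isomorphism. [cite: MochizukiFrdI2008, Thm. 6.4 (iv) p.116] -/
def Thm64iv_L07_isoOfDegreeEq : Prop :=
  ∀ (L₁ : Type) [Field L₁] [NumberField L₁] (L₂ : Type) [Field L₂] [NumberField L₂],
    Nonempty (L₁ →+* L₂) → Module.finrank ℚ L₁ = Module.finrank ℚ L₂ → Nonempty (L₁ ≃+* L₂)

end Literature.AlgebraicGeometry.Frobenioids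

end
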